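import Literature.NumberTheory.LFunctions.Zhang2022.Section8Step8u016
import Literature.NumberTheory.LFunctions.Zhang2022.Section11Deductions
import Literature.NumberTheory.LFunctions.Zhang2022.KnifeEdgeLenLongLegSplit

/-!
# Route `ZDegreeToeplitzBand`, crux `PsiGradedTablesClosePoly` (stmt-Parity-22438), line `long_poly_dil`, stub
# `stub_lemma81LongPsiDil` (P2-Dil): the §8 Lemma 8.1 chain RE-RUN AT TWO INDEPENDENT TRUNCATIONS — Part 4,
# the contour shift `𝔍(α) → 𝔍(1)` (Z22:§8.u016) for GENERIC data: `Σ_{Ψ₁} I⁺ = Theta1Ext + O(e^{−𝓛¹⁰/16})`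

Y. Zhang, *Discrete mean estimates and the Landau–Siegel zero*, arXiv:2211.02515v1 — an unrefereed manuscript under
adjudication. **The programme SEARCHES and TYPES; no claim about Landau–Siegel zeros, Theorems 1–2 of arXiv:2211.02515
or a repaired Margin232 until a kernel theorem says so.**

"Moving the segment `𝔍(α)` to `𝔍(1)` gives `Σ_{ψ∈Ψ₁} I₁⁺(𝐚₁,𝐚₂;ψ) = Θ₁(𝐚₁,𝐚₂) + O(ε)`" (§8 p. 43): the tree's
`Step8u016.step8u016_of` (from Prop. 2.2 (i)) is typed at `Apoly`/`Adm72`. The data enter that proof only through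
holomorphy and the trivial size `|A| ≤ B·N²` on the rectangle `[½+α, 3/2] × [2πt₀ ± 𝓛₁]`; here the kernel part
`𝒞(s,ψ)ω(s)` is isolated by the tree's `δ₁`-evaluation (`Section11Deductions.Apoly_delta1`: `A(δ₁;s) = 1`), so the tree's
side bound `Step8u016.norm_integrandC_le_uniform` at `(δ₁,δ₁)` bounds `|𝒞ω|`, and the generic polynomials
`A_{N₁}(a₁;s)A_{N₂}(a₂;1−s)` (`N₁,N₂ ≤ P³`, `|a| ≤ P¹⁰`) cost `P³²`, absorbed by `e^{−𝓛¹⁰/4}`: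
`‖Σ_{Ψ₁} I⁺_{N₁,N₂}(a₁,a₂) − Theta1Ext c′ χ N₁ N₂ a₁ a₂‖ ≤ e^{−𝓛¹⁰/16}` (`lemma81Ext_shift`). This discharges the
`hshift` input of `lemma81Ext_of_meanSquare_of_shift` (Part 3). Theorems only; no definitions; no new named facts.
Prover: ls-knife-typer-3 g20 (cell landau-siegel §D), `--supports` stmt-Parity-22438.
[cite: Zhang2022LandauSiegel, §8 p. 43, tex L2255–2258]
-/

noncomputable section

open Complex Real Set
open Literature.NumberTheory.LFunctions.Zhang2022
open Literature.NumberTheory.LFunctions.Zhang2022.Skeleton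
open Literature.NumberTheory.LFunctions.Zhang2022.Section8aStatements
open Literature.NumberTheory.LFunctions.Zhang2022.KnifeEdge.LongLegSplit

namespace Summit.Parity.GeneralizedHardyLittlewood.Theorems

/-- The `I⁺`/`Θ₁` integrand at two truncations factors through the tree's `integrandC` at `(δ₁,δ₁)`:
`𝒞·A_{N₁}(a₁;s)·A_{N₂}(a₂;1−s)·ω = [𝒞·A(δ₁;s)A(δ₁;1−s)·ω]·(A_{N₁}(a₁;s)A_{N₂}(a₂;1−s))` (`A(δ₁;·) = 1` for `𝓛 ≥ 2`).
[cite: Zhang2022LandauSiegel, §7 p. 13; §8 p. 43] -/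
theorem lemma81Ext_integrandC_factor (c' : ℝ) {D : ℕ} (x : Chr D) (hℓ : 2 ≤ ell D) (N₁ N₂ : ℕ) (a₁ a₂ : ℕ → ℂ)
    (s : ℂ) :
    frakcW c' x s * Lemma81.dirPoly N₁ a₁ x.ψ s * Lemma81.dirPoly N₂ a₂ x.ψ⁻¹ (1 - s) * omegaW D s =
      integrandC c' x (Pi.single 1 1) (Pi.single 1 1) s *
        (Lemma81.dirPoly N₁ a₁ x.ψ s * Lemma81.dirPoly N₂ a₂ x.ψ⁻¹ (1 - s)) := by
  rw [integrandC, Section11Deductions.Apoly_delta1 x hℓ, Section11Deductions.ApolyBar_delta1 x hℓ]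
  ring

/-- The generic polynomials on the rectangle `[½+α, 3/2] × ℝ`: `|A_{N₁}(a₁;s)A_{N₂}(a₂;1−s)| ≤ P³²` for `N₁,N₂ ≤ P³`,
`|a₁|,|a₂| ≤ P¹⁰`, `½ ≤ Re s ≤ 3/2` (`|A_N(a;w)| ≤ B·N²` for `Re w ≥ −1`, the tree's `Step8u016.norm_dirPoly_le`).
[cite: Zhang2022LandauSiegel, §7 (7.2) p. 32] -/
theorem lemma81Ext_norm_AA_le_rect {D : ℕ} (x : Chr D) {N₁ N₂ : ℕ} {a₁ a₂ : ℕ → ℂ}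
    (hN₁ : (N₁ : ℝ) ≤ bigP D ^ 3) (hN₂ : (N₂ : ℝ) ≤ bigP D ^ 3)
    (ha₁ : ∀ n, ‖a₁ n‖ ≤ bigP D ^ 10) (ha₂ : ∀ n, ‖a₂ n‖ ≤ bigP D ^ 10) {s : ℂ}
    (hs1 : 1 / 2 ≤ s.re) (hs2 : s.re ≤ 3 / 2) :
    ‖Lemma81.dirPoly N₁ a₁ x.ψ s * Lemma81.dirPoly N₂ a₂ x.ψ⁻¹ (1 - s)‖ ≤ bigP D ^ 32 := by
  have hP : 0 ≤ bigP D := (Real.exp_pos _).le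
  have h1 : ‖Lemma81.dirPoly N₁ a₁ x.ψ s‖ ≤ bigP D ^ 10 * (N₁ : ℝ) ^ 2 :=
    Step8u016.norm_dirPoly_le N₁ ha₁ x.ψ (by linarith)
  have h2 : ‖Lemma81.dirPoly N₂ a₂ x.ψ⁻¹ (1 - s)‖ ≤ bigP D ^ 10 * (N₂ : ℝ) ^ 2 :=
    Step8u016.norm_dirPoly_le N₂ ha₂ x.ψ⁻¹ (by simp only [sub_re, one_re]; linarith)
  rw [norm_mul]
  calc ‖Lemma81.dirPoly N₁ a₁ x.ψ s‖ * ‖Lemma81.dirPoly N₂ a₂ x.ψ⁻¹ (1 - s)‖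
      ≤ (bigP D ^ 10 * (N₁ : ℝ) ^ 2) * (bigP D ^ 10 * (N₂ : ℝ) ^ 2) :=
        mul_le_mul h1 h2 (norm_nonneg _) (by positivity)
    _ ≤ (bigP D ^ 10 * (bigP D ^ 3) ^ 2) * (bigP D ^ 10 * (bigP D ^ 3) ^ 2) := by gcongr
    _ = bigP D ^ 32 := by ring

/-- **Z22:§8.u016 AT TWO INDEPENDENT TRUNCATIONS, for generic data, as an edge from Proposition 2.2 (i):**
for every `c′`, for all large `D`, under (A), for all `N₁, N₂ ≤ P³` and `|a₁|, |a₂| ≤ P¹⁰`,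
`‖Σ_{ψ∈Ψ₁} (1/2πi)∫_{𝔍(α)} 𝒞A_{N₁}(a₁)A_{N₂}(a₂;1−·)ω − Theta1Ext c′ χ N₁ N₂ a₁ a₂‖ ≤ e^{−𝓛¹⁰/16}`. Per `ψ`, Cauchy's
theorem on `[½+α, 3/2] × [2πt₀−𝓛₁, 2πt₀+𝓛₁]` (`Section7aStatements.norm_intJ_sub_intJ_le`; holomorphy from
`Step8u016.differentiableOn_integrandC` at `(δ₁,δ₁)` times the entire polynomials) leaves the two horizontal sides, each
`≤ K·P¹²e^{3C𝓛⁹(1+9log𝓛)}e^{−𝓛¹⁰/4}·P³²` pointwise; summing over `#Ψ₁ ≤ 𝔓 ≤ 4P²` and absorbing `P⁴⁶`,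
`e^{O(𝓛⁹log𝓛)}` and the constants (`Step8u016.growth_le`, `32𝓛⁹ ≤ 𝓛¹⁰/32`) gives `e^{−𝓛¹⁰/16}`.
[cite: Zhang2022LandauSiegel, §8 p. 43, tex L2255–2258] -/
theorem lemma81Ext_shift (h22 : Prop22i) (c' : ℝ) :
    ForAllLarge fun D _ χ => AssumptionA D χ → ∀ (N₁ N₂ : ℕ) (a₁ a₂ : ℕ → ℂ),
      (N₁ : ℝ) ≤ bigP D ^ 3 → (N₂ : ℝ) ≤ bigP D ^ 3 →
      (∀ n, ‖a₁ n‖ ≤ bigP D ^ 10) → (∀ n, ‖a₂ n‖ ≤ bigP D ^ 10) →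
        ‖(∑ x ∈ finsetOf (PsiOne χ), Lemma81.segInt (t0 D) (ell1 D) ((alpha D : ℝ) : ℂ) (fun s =>
              frakcW c' x s * Lemma81.dirPoly N₁ a₁ x.ψ s * Lemma81.dirPoly N₂ a₂ x.ψ⁻¹ (1 - s) * omegaW D s)) -
            Theta1Ext c' χ N₁ N₂ a₁ a₂‖ ≤ Real.exp (-(1 / 16) * ell D ^ 10) := by
  classical
  obtain ⟨C, hC0, hC⟩ := Literature.NumberTheory.LFunctions.DirichletDisc.exp_neg_le_norm_LFunction
  obtain ⟨D₁, h22'⟩ := h22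
  obtain ⟨D₂, hfrakP⟩ := Step8u016.frakP_le_eventually
  set K : ℝ := 3 * Real.exp 3 * (39 * Literature.NumberTheory.LFunctions.DirichletDisc.Zc) ^ 3 * 16 * 6 with hK
  have hK0 : 0 < K := by rw [hK]; have := Literature.NumberTheory.LFunctions.DirichletDisc.one_le_Zc; positivity
  obtain ⟨D₃, hD₃f⟩ := Skeleton.exists_forall_le_ell
    (max 1024 (max (π * |c'| + 1) (max (4 * K + 1) ((8 * (14 + 57 * C)) ^ 2))))
  refine ⟨max (max D₁ D₂) (max D₃ 3), fun D _ χ hD hq hp hA N₁ N₂ a₁ a₂ hN₁ hN₂ ha₁ ha₂ => ?_⟩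
  have hD₁ : D₁ ≤ D := le_trans (le_trans (le_max_left _ _) (le_max_left _ _)) hD
  have hD₂ : D₂ ≤ D := le_trans (le_trans (le_max_right _ _) (le_max_left _ _)) hD
  have hD₃ : D₃ ≤ D := le_trans (le_trans (le_max_left _ _) (le_max_right _ _)) hD
  have hD3 : 3 ≤ D := le_trans (le_trans (le_max_right _ _) (le_max_right _ _)) hD
  have hM := hD₃f D hD₃
  have hℓ1024 : 1024 ≤ ell D := le_trans (le_max_left _ _) hM
  have hℓ3 : 3 ≤ ell D := by linarith
  have hℓc : π * |c'| + 1 ≤ ell D := le_trans (le_trans (le_max_left _ _) (le_max_right _ _)) hM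
  have hℓK : 4 * K + 1 ≤ ell D :=
    le_trans (le_trans (le_trans (le_max_left _ _) (le_max_right _ _)) (le_max_right _ _)) hM
  have hℓA : (8 * (14 + 57 * C)) ^ 2 ≤ ell D :=
    le_trans (le_trans (le_trans (le_max_right _ _) (le_max_right _ _)) (le_max_right _ _)) hM
  have hℓ1 : 1 ≤ ell D := by linarith
  have hℓ2 : 2 ≤ ell D := by linarith
  have h22D := h22' D χ hD₁ hq hp
  obtain ⟨hα0, hα6, hα1⟩ := Step8u016.alpha_small hℓ3
  obtain ⟨hwin, -, -, -, hℓ10⟩ := Step8u016.window_sizes hℓ3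
  have hc8 : π * |c'| ≤ ell D ^ 8 := by
    have : ell D ≤ ell D ^ 8 := le_self_pow₀ hℓ1 (by norm_num)
    linarith
  have hδ : Adm72 D 1 (Pi.single 1 1 : ℕ → ℂ) := Section11Deductions.adm72_delta1 hℓ2
  -- the uniform side bound
  set Mval : ℝ := K * 1 ^ 2 * bigP D ^ 12 * Real.exp (3 * C * ell D ^ 9 * (1 + 9 * Real.log (ell D))) *
    Real.exp (-(ell D ^ 10) / 4) * bigP D ^ 32 with hMval
  have hMval0 : 0 ≤ Mval := by rw [hMval]; positivity
  -- per character
  have hper : ∀ x ∈ finsetOf (PsiOne χ),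
      ‖Lemma81.segInt (t0 D) (ell1 D) ((alpha D : ℝ) : ℂ) (fun s =>
            frakcW c' x s * Lemma81.dirPoly N₁ a₁ x.ψ s * Lemma81.dirPoly N₂ a₂ x.ψ⁻¹ (1 - s) * omegaW D s) -
          Lemma81.segInt (t0 D) (ell1 D) 1 (fun s =>
            frakcW c' x s * Lemma81.dirPoly N₁ a₁ x.ψ s * Lemma81.dirPoly N₂ a₂ x.ψ⁻¹ (1 - s) * omegaW D s)‖ ≤
        Mval := by
    intro x hx
    have hx' : x ∈ PsiOne χ := mem_of_mem_finsetOf hx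
    have h22x : ∀ s ∈ prodZeroSetOmega χ x, s.re = 1 / 2 := h22D x hx'
    set F : ℂ → ℂ := fun s =>
      frakcW c' x s * Lemma81.dirPoly N₁ a₁ x.ψ s * Lemma81.dirPoly N₂ a₂ x.ψ⁻¹ (1 - s) * omegaW D s with hFdef
    have hFeq : F = fun s => integrandC c' x (Pi.single 1 1) (Pi.single 1 1) s *
        (Lemma81.dirPoly N₁ a₁ x.ψ s * Lemma81.dirPoly N₂ a₂ x.ψ⁻¹ (1 - s)) := by
      funext s; exact lemma81Ext_integrandC_factor c' x hℓ2 N₁ N₂ a₁ a₂ s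
    have hAA : Differentiable ℂ fun s => Lemma81.dirPoly N₁ a₁ x.ψ s * Lemma81.dirPoly N₂ a₂ x.ψ⁻¹ (1 - s) :=
      (Section7aStatements.differentiable_dirPoly N₁ a₁ x.ψ x.p_ne_one).mul
        ((Section7aStatements.differentiable_dirPoly N₂ a₂ x.ψ⁻¹ x.p_ne_one).comp
          ((differentiable_const _).sub differentiable_id))
    have hF : DifferentiableOn ℂ F (Set.uIcc (1 / 2 + alpha D) (1 / 2 + 1) ×ℂ
        Set.uIcc (2 * π * t0 D - ell1 D) (2 * π * t0 D + ell1 D)) := by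
      rw [hFeq]
      exact (Step8u016.differentiableOn_integrandC c' x h22x hα0 hα1 hwin _ _).mul hAA.differentiableOn
    have hside : ∀ t : ℝ, (t = 2 * π * t0 D + ell1 D ∨ t = 2 * π * t0 D - ell1 D) →
        ∀ u ∈ Set.Icc (1 / 2 + alpha D) (1 / 2 + 1), ‖F ((u : ℂ) + ((t : ℝ) : ℂ) * I)‖ ≤ Mval := by
      intro t ht u hu
      have h := Step8u016.norm_integrandC_le_uniform c' hC0 hC x h22x hD3 hℓ3 hc8 hδ hδ hu.1 hu.2 ht
      have hA := lemma81Ext_norm_AA_le_rect x hN₁ hN₂ ha₁ ha₂ (s := (u : ℂ) + ((t : ℝ) : ℂ) * I)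
        (by simp; linarith [hu.1]) (by simp; linarith [hu.2])
      rw [hFeq]
      simp only
      rw [norm_mul, hMval, hK]
      exact mul_le_mul h hA (norm_nonneg _) (by positivity)
    have hmove := Section7aStatements.norm_intJ_sub_intJ_le D (z₁ := alpha D) (z₂ := 1)
      (M₁ := Mval) (M₂ := Mval) hα1 hF (hside _ (Or.inl rfl)) (hside _ (Or.inr rfl))
    have hI : Lemma81.segInt (t0 D) (ell1 D) ((alpha D : ℝ) : ℂ) F - Lemma81.segInt (t0 D) (ell1 D) 1 F =
        (Section7aStatements.intJ D (alpha D) F - Section7aStatements.intJ D 1 F) / (2 * π * I) := by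
      rw [show (1 : ℂ) = ((1 : ℝ) : ℂ) by norm_num, Step8u016.segInt_eq_intJ_div,
        Step8u016.segInt_eq_intJ_div, sub_div]
    have hnorm2 : ‖(2 : ℂ) * π * I‖ = 2 * π := by
      rw [norm_mul, norm_mul, Complex.norm_I, mul_one, Complex.norm_real, Real.norm_eq_abs,
        abs_of_pos Real.pi_pos]
      norm_num
    rw [hI, norm_div, hnorm2, ← norm_neg, neg_sub, div_le_iff₀ (by positivity)]
    calc ‖Section7aStatements.intJ D 1 F - Section7aStatements.intJ D (alpha D) F‖
        ≤ (1 - alpha D) * (Mval + Mval) := hmove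
      _ ≤ 1 * (Mval + Mval) := by gcongr; linarith
      _ ≤ Mval * (2 * π) := by nlinarith [Real.pi_gt_three]
  -- summing over `Ψ₁`
  have hΘ : Theta1Ext c' χ N₁ N₂ a₁ a₂ = ∑ x ∈ finsetOf (PsiOne χ), Lemma81.segInt (t0 D) (ell1 D) 1 (fun s =>
      frakcW c' x s * Lemma81.dirPoly N₁ a₁ x.ψ s * Lemma81.dirPoly N₂ a₂ x.ψ⁻¹ (1 - s) * omegaW D s) := rfl
  have hsum : ‖(∑ x ∈ finsetOf (PsiOne χ), Lemma81.segInt (t0 D) (ell1 D) ((alpha D : ℝ) : ℂ) (fun s =>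
          frakcW c' x s * Lemma81.dirPoly N₁ a₁ x.ψ s * Lemma81.dirPoly N₂ a₂ x.ψ⁻¹ (1 - s) * omegaW D s)) -
        Theta1Ext c' χ N₁ N₂ a₁ a₂‖ ≤ (finsetOf (PsiOne χ)).card * Mval := by
    rw [hΘ, ← Finset.sum_sub_distrib]
    refine (norm_sum_le _ _).trans ?_
    calc ∑ x ∈ finsetOf (PsiOne χ),
          ‖Lemma81.segInt (t0 D) (ell1 D) ((alpha D : ℝ) : ℂ) (fun s =>
              frakcW c' x s * Lemma81.dirPoly N₁ a₁ x.ψ s * Lemma81.dirPoly N₂ a₂ x.ψ⁻¹ (1 - s) * omegaW D s) -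
            Lemma81.segInt (t0 D) (ell1 D) 1 (fun s =>
              frakcW c' x s * Lemma81.dirPoly N₁ a₁ x.ψ s * Lemma81.dirPoly N₂ a₂ x.ψ⁻¹ (1 - s) * omegaW D s)‖
        ≤ ∑ x ∈ finsetOf (PsiOne χ), Mval := Finset.sum_le_sum hper
      _ = (finsetOf (PsiOne χ)).card * Mval := by rw [Finset.sum_const, nsmul_eq_mul]
  have hcard : ((finsetOf (PsiOne χ)).card : ℝ) ≤ 4 * bigP D ^ 2 :=
    (Ded81Edge.card_finsetOf_psiOne_le_frakP χ).trans (hfrakP D hD₂ hℓ1)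
  refine hsum.trans ((mul_le_mul_of_nonneg_right hcard hMval0).trans ?_)
  -- the final size estimate: `4P²·Mval ≤ e^{−𝓛¹⁰/16}`
  have hP : bigP D = Real.exp (ell D ^ 9) := rfl
  have hgrowth := Step8u016.growth_le hC0.le hℓ1 (by
    calc 8 * (14 + 57 * C) = Real.sqrt ((8 * (14 + 57 * C)) ^ 2) := by
          rw [Real.sqrt_sq (by positivity)]
      _ ≤ Real.sqrt (ell D) := Real.sqrt_le_sqrt hℓA)
  -- `4K ≤ e^{𝓛¹⁰/32}`
  have hℓ10 : ell D ≤ ell D ^ 10 / 32 := by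
    have h9 : (32 : ℝ) ≤ ell D ^ 9 := by
      calc (32 : ℝ) ≤ 1024 := by norm_num
        _ ≤ ell D := hℓ1024
        _ ≤ ell D ^ 9 := le_self_pow₀ hℓ1 (by norm_num)
    have : ell D * 32 ≤ ell D ^ 10 := by
      calc ell D * 32 ≤ ell D * ell D ^ 9 := by gcongr
        _ = ell D ^ 10 := by ring
    linarith
  have hconst : 4 * K ≤ Real.exp (ell D ^ 10 / 32) := by
    calc 4 * K ≤ ell D ^ 10 / 32 := by linarith
      _ ≤ ell D ^ 10 / 32 + 1 := by linarith
      _ ≤ Real.exp (ell D ^ 10 / 32) := Real.add_one_le_exp _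
  -- `P¹⁴ e^{3C𝓛⁹(1+9log𝓛)} ≤ e^{𝓛¹⁰/8}`, `P³² ≤ e^{𝓛¹⁰/32}`
  have hP14 : bigP D ^ 14 = Real.exp (14 * ell D ^ 9) := by rw [hP, ← Real.exp_nat_mul]; norm_num
  have hmid : bigP D ^ 14 * Real.exp (3 * C * ell D ^ 9 * (1 + 9 * Real.log (ell D))) ≤
      Real.exp (ell D ^ 10 / 8) := by
    rw [hP14, ← Real.exp_add, Real.exp_le_exp]
    have : 14 * ell D ^ 9 + 3 * C * ell D ^ 9 * (1 + 9 * Real.log (ell D)) =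
        (14 + 3 * C) * ell D ^ 9 + 27 * C * ell D ^ 9 * Real.log (ell D) := by ring
    rw [this]; exact hgrowth
  have hP32 : bigP D ^ 32 ≤ Real.exp (ell D ^ 10 / 32) := by
    rw [hP, ← Real.exp_nat_mul, Real.exp_le_exp]
    push_cast
    have : ell D ^ 10 = ell D * ell D ^ 9 := by ring
    nlinarith [pow_nonneg (show (0 : ℝ) ≤ ell D by linarith) 9]
  have e : 4 * bigP D ^ 2 * Mval = (4 * K) *
      (bigP D ^ 14 * Real.exp (3 * C * ell D ^ 9 * (1 + 9 * Real.log (ell D)))) * bigP D ^ 32 *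
      Real.exp (-(ell D ^ 10) / 4) := by
    rw [hMval]; ring
  rw [e]
  have h1 := mul_le_mul hconst hmid (by positivity) (Real.exp_pos _).le
  have h2 := mul_le_mul h1 hP32 (by positivity) (by positivity)
  have h3 := mul_le_mul_of_nonneg_right h2 (Real.exp_pos (-(ell D ^ 10) / 4)).le
  refine h3.trans (le_of_eq ?_)
  rw [← Real.exp_add, ← Real.exp_add, ← Real.exp_add]
  congr 1; ring

end Summit.Parity.GeneralizedHardyLittlewood.Theorems

end
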